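import Mathlib
import Literature.AlgebraicGeometry.Motives.RatFnBirationalHartogs
import Literature.AlgebraicGeometry.Motives.RatFnAffine
import Literature.AlgebraicGeometry.Motives.CartierDivisorCurveDegree
import Literature.AlgebraicGeometry.Resolution.RegularLocalRingsUFD
import Literature.RingTheory.UniqueFactorizationDomain.HeightOnePrimes
import HarnessLib

/-!
# [OURS · L1 w44b] K-PCC sheaf half, FILE 2a: algebraic Hartogs at codimension-one points —
# a rational function regular at every point of codimension `≤ 1` of an open of a regular scheme is
# regular there; `ord_ζ h ≥ 0 ⇒ h` regular at a codimension-one point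

Rung S-2 `HomologicalConductor.PersistenceSurface` (stmt-ResolutionOfSingularities-19970), route
`ResolutionOfSingularities/HomologicalConductor`, chain W4.4b (cell res-hironaka), WAVE-3 row «stub-3 → K-PCC
SHEAF HALF» (lead memo K-PCC, res-L1-w44b-lead-1 g4). `[OURS · L1 w44b]` folklore (Görtz–Wedhorn I Thm. 6.45,
Prop. B.73), adapted from the tree's `Motives/RatFnBirationalHartogs` (algebraic Hartogs ALONG A SURJECTION,
`RatFn.isRegularAt_of_forall_isRegularAt_comap{,_affine}`), whose statement quantifies over ALL points of the
open; FILE 2b (sections of `𝒪_X(D)` off the closed fibre are global sections of `𝒪_X(D + D_W)`) needs the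
sharper hypothesis «regular at the points of codimension `≤ 1` only». Replaces the role of no printed item;
NOT a statement of the manuscript under review; AI-written, weaker than expert review.

* `isRegularAt_of_ord_nonneg` — at a codimension-one point `ζ` with regular local ring, a non-zero rational
  function with `ord_ζ h ≥ 0` is regular (`𝒪_{X,ζ}` is a valuation ring: else `h⁻¹ ∈ 𝔪_ζ` has positive order);
* **`isRegularAt_of_forall_coheight_le_one`** — for an affine open `V` of an integral scheme with regular
  local rings: if `h` is regular at every `y' ∈ V` with `coheight y' ≤ 1`, then `h` is regular at every point
  of `V` (`𝒪_{X,y}` is factorial, so `𝒪_{X,y} = ⋂_ϖ (𝒪_{X,y})_{(ϖ)}`, and `(𝒪_{X,y})_{(ϖ)}` is the local ring of a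
  codimension-one point of `V`); `isRegularAt_of_forall_coheight_le_one_of_mem` — the same for any open.

References: U. Görtz, T. Wedhorn, *Algebraic Geometry I* (2nd ed. 2020), Thm. 6.45 (p. 203), Prop. B.73 (3)
(p. 571) [`GortzWedhorn2020`]; H. Matsumura, *Commutative Ring Theory* (1986), Thm. 11.5, Thm. 20.3
[`Matsumura1987`].
-/

set_option linter.dupNamespace false
set_option autoImplicit false

noncomputable section

open CategoryTheory AlgebraicGeometry TopologicalSpace IsLocalRing Opposite Order Ideal
open Literature.AlgebraicGeometry.Motives Literature.AlgebraicGeometry.Motives.RatFn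
open Literature.RingTheory.UniqueFactorizationDomain

universe u

namespace Summit.ResolutionOfSingularities.ResolutionOfSingularities.Theorems.HomologicalConductor.PersistencePointedCeiling

variable {X : Scheme.{u}} [IsIntegral X]

/-! ## `ord ≥ 0` at a codimension-one point forces regularity -/

/-- **`ord_ζ h ≥ 0 ⇒ h ∈ 𝒪_{X,ζ}`** at a codimension-one point `ζ` whose local ring is regular (a discrete
valuation ring): otherwise `h⁻¹` is regular and not a unit, of positive order, contradicting
`ord h + ord h⁻¹ = 0`. [cite: GortzWedhorn2020, Prop. B.73 (3) (p. 571)] -/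
theorem isRegularAt_of_ord_nonneg [IsLocallyNoetherian X] {ζ : X}
    (hreg : IsRegularLocalRing (X.presheaf.stalk ζ)) (hζ : coheight ζ = 1) {h : X.functionField}
    (h0 : h ≠ 0) (hord : 0 ≤ Scheme.ord h ζ) : IsRegularAt ζ h := by
  haveI := hreg
  haveI := Literature.AlgebraicGeometry.Resolution.isDomain_of_isRegularLocalRing (X.presheaf.stalk ζ)
  have hdim : ringKrullDim (X.presheaf.stalk ζ) ≤ 1 := by
    rw [ringKrullDim_stalk_eq_coheight ζ, hζ]; exact le_rfl
  haveI := valuationRing_of_isRegularLocalRing_of_ringKrullDim_le_one (X.presheaf.stalk ζ) hdim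
  rcases ValuationRing.isInteger_or_isInteger (X.presheaf.stalk ζ) h with hint | hint
  · exact (isRegularAt_iff_isInteger ζ h).mpr hint
  · have hinv : IsRegularAt ζ h⁻¹ := (isRegularAt_iff_isInteger ζ h⁻¹).mpr hint
    by_cases hu : IsUnitAt ζ h⁻¹
    · simpa using hu.inv.isRegularAt
    · have hpos := hinv.ord_pos hu (inv_ne_zero h0) hζ
      have hsum : Scheme.ord h ζ + Scheme.ord h⁻¹ ζ = 0 := by
        rw [← Scheme.ord_mul h0 (inv_ne_zero h0), mul_inv_cancel₀ h0]
        exact isUnitAt_one.ord_eq_zero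
      omega

/-! ## Hartogs at the points of codimension `≤ 1` -/

/-- **Algebraic Hartogs on an affine chart, codimension-`≤ 1` form.** Let `X` be integral with regular local
rings, `V ⊆ X` an affine open and `h ∈ K(X)` regular at every point `y' ∈ V` of codimension `≤ 1`
(`coheight y' ≤ 1`). Then `h` is regular at every point of `V`: `𝒪_{X,y}` is factorial, hence the
intersection of its localisations `(𝒪_{X,y})_{(ϖ)}` at prime elements, and `(𝒪_{X,y})_{(ϖ)}` is the local
ring of the codimension-one generisation `y_ϖ ∈ V` of `y`. (Adapted from the tree's
`RatFn.isRegularAt_of_forall_isRegularAt_comap_affine`, which asks regularity at ALL points over `V`.)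
[cite: GortzWedhorn2020, Thm. 6.45 (p. 203) and Prop. B.73 (3) (p. 571)] [cite: Matsumura1987, Thm. 20.3] -/
theorem isRegularAt_of_forall_coheight_le_one (hY : ∀ y : X, IsRegularLocalRing (X.presheaf.stalk y))
    {V : X.Opens} (hV : IsAffineOpen V) {h : X.functionField}
    (hh : ∀ y' : X, y' ∈ V → coheight y' ≤ 1 → IsRegularAt y' h) (y : V) :
    IsRegularAt (y : X) h := by
  classical
  haveI : Nonempty V := ⟨y⟩
  haveI : IsRegularLocalRing (X.presheaf.stalk (y : X)) := hY y
  haveI := Literature.AlgebraicGeometry.Resolution.isDomain_of_isRegularLocalRing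
    (X.presheaf.stalk (y : X))
  haveI : UniqueFactorizationMonoid (X.presheaf.stalk (y : X)) :=
    Literature.AlgebraicGeometry.Resolution.IsRegularLocalRing.uniqueFactorizationMonoid _
  haveI := hV.isLocalization_stalk y
  -- Hartogs for the factorial ring `𝒪_{X,y}`
  suffices hx : ∀ ϖ : X.presheaf.stalk (y : X), Prime ϖ → ∃ d e : X.presheaf.stalk (y : X),
      ¬ ϖ ∣ e ∧ h * toFunctionField (y : X) e = toFunctionField (y : X) d by
    obtain ⟨r, hr⟩ := exists_algebraMap_eq_of_forall_prime (R := X.presheaf.stalk (y : X)) h hx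
    exact ⟨r, hr⟩
  intro ϖ hϖ
  -- the height-one prime `(ϖ)`, its trace `p` on `Γ(X, V)`, and the point `y' = y_ϖ ∈ V`
  haveI hϖp : (span {ϖ} : Ideal (X.presheaf.stalk (y : X))).IsPrime :=
    (span_singleton_prime hϖ.ne_zero).2 hϖ
  have hϖ1 : (span {ϖ} : Ideal (X.presheaf.stalk (y : X))).height ≤ 1 :=
    height_le_one_of_isPrincipal_of_mem_minimalPrimes (span {ϖ}) (span {ϖ})
      (by rw [Ideal.minimalPrimes_eq_subsingleton_self]; exact Set.mem_singleton _)
  set p : Ideal Γ(X, V) := (span {ϖ} : Ideal (X.presheaf.stalk (y : X))).under Γ(X, V) with hp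
  haveI hpp : p.IsPrime := IsPrime.under _ _
  obtain ⟨y', hpy'⟩ : ∃ y' : V, hV.primeIdealOf y' = ⟨p, hpp⟩ :=
    ⟨⟨hV.fromSpec ⟨p, hpp⟩, hV.range_fromSpec.le ⟨_, rfl⟩⟩, by
      apply hV.fromSpec.isOpenEmbedding.injective
      rw [hV.fromSpec_primeIdealOf]⟩
  -- `coheight y' = dim 𝒪_{X,y'} = ht p = ht (ϖ) ≤ 1`
  haveI := hV.isLocalization_stalk y'
  have hdim : ringKrullDim (X.presheaf.stalk (y' : X)) ≤ 1 := by
    rw [IsLocalization.AtPrime.ringKrullDim_eq_height (hV.primeIdealOf y').asIdeal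
      (X.presheaf.stalk (y' : X)), hpy']
    change ((p.height : ℕ∞) : WithBot ℕ∞) ≤ 1
    rw [hp, IsLocalization.height_under (hV.primeIdealOf y).asIdeal.primeCompl
      (span {ϖ} : Ideal (X.presheaf.stalk (y : X)))]
    exact_mod_cast hϖ1
  have hcoh : coheight (y' : X) ≤ 1 := by
    have h1 := hdim
    rw [ringKrullDim_stalk_eq_coheight (y' : X)] at h1
    exact_mod_cast h1
  -- so `h` is regular at `y'` by hypothesis
  have hreg' : IsRegularAt (y' : X) h := hh y' y'.2 hcoh
  -- read off a denominator not divisible by `ϖ`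
  obtain ⟨a, b, hb, e⟩ := (isRegularAt_iff_exists hV y' h).1 hreg'
  rw [hpy'] at hb
  refine ⟨algebraMap Γ(X, V) _ a, algebraMap Γ(X, V) _ b, fun hdvd => hb ?_, ?_⟩
  · exact mem_comap.2 (mem_span_singleton.2 hdvd)
  · rw [toFunctionField_algebraMap_stalk, toFunctionField_algebraMap_stalk, e]

/-- **Algebraic Hartogs, codimension-`≤ 1` form, on any open**: `X` integral with regular local rings,
`W ⊆ X` open, `h` regular at every point of `W` of codimension `≤ 1` ⇒ `h` regular at every point of `W`.
[cite: GortzWedhorn2020, Thm. 6.45 (p. 203)] -/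
theorem isRegularAt_of_forall_coheight_le_one_of_mem (hY : ∀ y : X, IsRegularLocalRing (X.presheaf.stalk y))
    {W : X.Opens} {h : X.functionField} (hh : ∀ y' : X, y' ∈ W → coheight y' ≤ 1 → IsRegularAt y' h)
    {y : X} (hy : y ∈ W) : IsRegularAt y h := by
  obtain ⟨V, hV, hyV, hVW⟩ := exists_isAffineOpen_mem_and_subset (U := W) hy
  exact isRegularAt_of_forall_coheight_le_one hY hV (fun y' hy' hc => hh y' (hVW hy') hc) ⟨y, hyV⟩

end Summit.ResolutionOfSingularities.ResolutionOfSingularities.Theorems.HomologicalConductor.PersistencePointedCeiling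

end
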